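import Summits.CriticalPhenomena.PercolationContinuityZ3.Theorems.PercNearOneGluingNoHeavyLowerTailSahiTangentCylinderPoly
import Summits.CriticalPhenomena.PercolationContinuityZ3.Theorems.PercNearOneGluingNoHeavyLowerTailSahiTangentChain
import Literature.Combinatorics.Sahi2008.Percolation
import Literature.Probability.LatticeModels.ProdBernoulliIndependence

/-!
# `NoHeavyLowerTail` (crux stmt-CriticalPhenomena-4575), Sahi programme: **THE TANGENT / CONTRACTION INEQUALITY FOR CYLINDER PAIRS ON EVERY
# CUBE `{0,1}^ι` WITH A PRODUCT MEASURE** — part 2: `T₃ ≥ 0` (the induction) and `s·E₃^{μ}(tops) ≤ E₃^{B_s⊗μ}(F)`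

Support file (Sahi cell, seat `prim-sahi-p1`, generation 48; `--supports stmt-CriticalPhenomena-4575`).  Pure proofs, standard axioms, no
`sorry`; the only definition is the termination measure `excess`.  Part 1 (`…SahiTangentCylinderPoly`) has the masses `cylMass`, the tangent
expression `T3cyl`, the frozen case and the one-step reduction lemmas.

THE RESULTS.
* `T3cyl_nonneg`: for every cube `{0,1}^ι` (ι finite), every `p : ι → [0,1]` and all CYLINDER PAIRS `t_i ⊆ b_i` (`i < 3`), the 14-term tangent
  expression `T₃` of memo FROM-prim-sahi-p2-gen32-TANGENT is `≥ 0` — by induction on `excess` (number of defect coordinates lying in another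
  bottom): a positive excess admits a reduction step (part 1, `T3cyl_erase_le₀/₁/₂`), excess `0` is the frozen case (`T3cyl_nonneg_of_frozen`).
* **`sahiE_three_coin_cylinders_ge`**: THE CONTRACTION INEQUALITY for cylinder pairs — with `μ = bernoulliWeight p` (the product measure on
  `Set ι`), `s ∈ [0,1]`, cylinder events `C(A) = {ω | A ⊆ ω}` and `F_i(ε,ω) = ε ? 1_{C(t_i)}(ω) : 1_{C(b_i)}(ω)`:
  `s · E₃^{μ}(1_{C(t₀)},1_{C(t₁)},1_{C(t₂)}) ≤ E₃^{B_s⊗μ}(F₀,F₁,F₂)` — via the sections identity of `…SahiTangentChain` (p2 gen 32):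
  `E₃^{B_s⊗μ} − s·c₃ = (1−s)[(1−s)c₀ + sT₃ + s(1−s)Πδ]` with `c₀ = E₃(bottom cylinders) ≥ 0` (`E3cyl_nonneg`), `T₃ ≥ 0` (`T3cyl_nonneg`), `δ_i ≥ 0`.
CONTEXT.  Conjecture T₃ fails for general increasing events already on `{0,1}⁴ × coin` (gen 47, unions of cylinders); it holds for cylinder
pairs on every cube (this file), on chains (all orders, gen 47) and at J-width ≤ 2 (gen 48).  Numerically it also holds for principal pairs under
every FKG weight (seat folder code/gen48/tangent_principal_*; no global degree-3 minor certificate, kit j309271) — OPEN. [this work]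
-/

namespace Summit.CriticalPhenomena.PercolationContinuityZ3.Theorems.SahiTangentCyl

open Finset Literature.Probability.LatticeModels Literature.Combinatorics.Sahi2008
open Literature.Probability.Percolation.DecisionTree (ind ind_of_mem ind_of_not_mem)
open scoped BigOperators

noncomputable section

variable {ι : Type*} [DecidableEq ι] {p : ι → ℝ}

/-! ### The induction on `excess` -/

/-- The termination measure: the number of defect coordinates lying in another bottom. [this work] -/
def excess (t b : Fin 3 → Finset ι) : ℕ :=
  ((b 0 \ t 0) ∩ (b 1 ∪ b 2)).card + ((b 1 \ t 1) ∩ (b 0 ∪ b 2)).card + ((b 2 \ t 2) ∩ (b 0 ∪ b 1)).card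

/-- Erasing a removable coordinate from `b₀` decreases the measure. [this work] -/
theorem excess_erase_lt₀ (t b : Fin 3 → Finset ι) {e : ι} (he0 : e ∈ b 0) (het : e ∉ t 0) (he : e ∈ b 1 ∪ b 2) :
    excess t (Function.update b 0 ((b 0).erase e)) < excess t b := by
  have n10 : (1 : Fin 3) ≠ 0 := by decide
  have n20 : (2 : Fin 3) ≠ 0 := by decide
  unfold excess
  rw [Function.update_self, Function.update_of_ne n10, Function.update_of_ne n20]
  have hs : (b 0).erase e ⊆ b 0 := erase_subset e (b 0)
  have h1 : (((b 0).erase e \ t 0) ∩ (b 1 ∪ b 2)).card < ((b 0 \ t 0) ∩ (b 1 ∪ b 2)).card := by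
    apply card_lt_card
    refine ⟨inter_subset_inter (sdiff_subset_sdiff hs subset_rfl) subset_rfl, fun hcon => ?_⟩
    have hmem : e ∈ (b 0 \ t 0) ∩ (b 1 ∪ b 2) := mem_inter.2 ⟨mem_sdiff.2 ⟨he0, het⟩, he⟩
    have := mem_inter.1 (hcon hmem)
    exact ((mem_erase.1 (mem_sdiff.1 this.1).1).1) rfl
  have h2 : ((b 1 \ t 1) ∩ ((b 0).erase e ∪ b 2)).card ≤ ((b 1 \ t 1) ∩ (b 0 ∪ b 2)).card :=
    card_le_card (inter_subset_inter subset_rfl (union_subset_union hs subset_rfl))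
  have h3 : ((b 2 \ t 2) ∩ ((b 0).erase e ∪ b 1)).card ≤ ((b 2 \ t 2) ∩ (b 0 ∪ b 1)).card :=
    card_le_card (inter_subset_inter subset_rfl (union_subset_union hs subset_rfl))
  omega

/-- Erasing a removable coordinate from `b₁` decreases the measure. [this work] -/
theorem excess_erase_lt₁ (t b : Fin 3 → Finset ι) {e : ι} (he1 : e ∈ b 1) (het : e ∉ t 1) (he : e ∈ b 0 ∪ b 2) :
    excess t (Function.update b 1 ((b 1).erase e)) < excess t b := by
  have n01 : (0 : Fin 3) ≠ 1 := by decide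
  have n21 : (2 : Fin 3) ≠ 1 := by decide
  unfold excess
  rw [Function.update_self, Function.update_of_ne n01, Function.update_of_ne n21]
  have hs : (b 1).erase e ⊆ b 1 := erase_subset e (b 1)
  have h1 : (((b 1).erase e \ t 1) ∩ (b 0 ∪ b 2)).card < ((b 1 \ t 1) ∩ (b 0 ∪ b 2)).card := by
    apply card_lt_card
    refine ⟨inter_subset_inter (sdiff_subset_sdiff hs subset_rfl) subset_rfl, fun hcon => ?_⟩
    have hmem : e ∈ (b 1 \ t 1) ∩ (b 0 ∪ b 2) := mem_inter.2 ⟨mem_sdiff.2 ⟨he1, het⟩, he⟩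
    have := mem_inter.1 (hcon hmem)
    exact ((mem_erase.1 (mem_sdiff.1 this.1).1).1) rfl
  have h2 : ((b 0 \ t 0) ∩ ((b 1).erase e ∪ b 2)).card ≤ ((b 0 \ t 0) ∩ (b 1 ∪ b 2)).card :=
    card_le_card (inter_subset_inter subset_rfl (union_subset_union hs subset_rfl))
  have h3 : ((b 2 \ t 2) ∩ (b 0 ∪ (b 1).erase e)).card ≤ ((b 2 \ t 2) ∩ (b 0 ∪ b 1)).card :=
    card_le_card (inter_subset_inter subset_rfl (union_subset_union subset_rfl hs))
  omega

/-- Erasing a removable coordinate from `b₂` decreases the measure. [this work] -/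
theorem excess_erase_lt₂ (t b : Fin 3 → Finset ι) {e : ι} (he2 : e ∈ b 2) (het : e ∉ t 2) (he : e ∈ b 0 ∪ b 1) :
    excess t (Function.update b 2 ((b 2).erase e)) < excess t b := by
  have n02 : (0 : Fin 3) ≠ 2 := by decide
  have n12 : (1 : Fin 3) ≠ 2 := by decide
  unfold excess
  rw [Function.update_self, Function.update_of_ne n02, Function.update_of_ne n12]
  have hs : (b 2).erase e ⊆ b 2 := erase_subset e (b 2)
  have h1 : (((b 2).erase e \ t 2) ∩ (b 0 ∪ b 1)).card < ((b 2 \ t 2) ∩ (b 0 ∪ b 1)).card := by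
    apply card_lt_card
    refine ⟨inter_subset_inter (sdiff_subset_sdiff hs subset_rfl) subset_rfl, fun hcon => ?_⟩
    have hmem : e ∈ (b 2 \ t 2) ∩ (b 0 ∪ b 1) := mem_inter.2 ⟨mem_sdiff.2 ⟨he2, het⟩, he⟩
    have := mem_inter.1 (hcon hmem)
    exact ((mem_erase.1 (mem_sdiff.1 this.1).1).1) rfl
  have h2 : ((b 0 \ t 0) ∩ (b 1 ∪ (b 2).erase e)).card ≤ ((b 0 \ t 0) ∩ (b 1 ∪ b 2)).card :=
    card_le_card (inter_subset_inter subset_rfl (union_subset_union subset_rfl hs))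
  have h3 : ((b 1 \ t 1) ∩ (b 0 ∪ (b 2).erase e)).card ≤ ((b 1 \ t 1) ∩ (b 0 ∪ b 2)).card :=
    card_le_card (inter_subset_inter subset_rfl (union_subset_union subset_rfl hs))
  omega

/-- Erasing a non-top coordinate keeps `t ⊆ b`. [this work] -/
theorem subset_update_erase {t b : Fin 3 → Finset ι} (htb : ∀ l, t l ⊆ b l) (l : Fin 3) {e : ι} (het : e ∉ t l) :
    ∀ l', t l' ⊆ Function.update b l ((b l).erase e) l' := by
  intro l'
  by_cases hl' : l' = l
  · subst hl'
    rw [Function.update_self]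
    intro x hx
    exact mem_erase.2 ⟨fun hxe => het (hxe ▸ hx), htb _ hx⟩
  · rw [Function.update_of_ne hl']; exact htb l'

/-- **`T₃ ≥ 0` for all cylinder pairs** `t_i ⊆ b_i` of the cube `{0,1}^ι` under any product measure (`0 ≤ p ≤ 1`), by induction on `excess`.
[this work] -/
theorem T3cyl_nonneg_aux [Fintype ι] (hp0 : ∀ e, 0 ≤ p e) (hp1 : ∀ e, p e ≤ 1) :
    ∀ (n : ℕ) (t b : Fin 3 → Finset ι), (∀ l, t l ⊆ b l) → excess t b ≤ n → 0 ≤ T3cyl p t b := by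
  intro n
  induction n with
  | zero =>
    intro t b htb hex
    have h : excess t b = 0 := Nat.le_zero.1 hex
    unfold excess at h
    have h0 : ((b 0 \ t 0) ∩ (b 1 ∪ b 2)).card = 0 := by omega
    have h1 : ((b 1 \ t 1) ∩ (b 0 ∪ b 2)).card = 0 := by omega
    have h2 : ((b 2 \ t 2) ∩ (b 0 ∪ b 1)).card = 0 := by omega
    exact T3cyl_nonneg_of_frozen hp0 hp1 htb (card_eq_zero.1 h0) (card_eq_zero.1 h1) (card_eq_zero.1 h2)
  | succ n ih =>
    intro t b htb hex
    by_cases h0 : ((b 0 \ t 0) ∩ (b 1 ∪ b 2)).Nonempty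
    · obtain ⟨e, he⟩ := h0
      rw [mem_inter, mem_sdiff] at he
      have hlt := excess_erase_lt₀ t b he.1.1 he.1.2 he.2
      exact (ih _ _ (subset_update_erase htb 0 he.1.2) (by omega)).trans (T3cyl_erase_le₀ hp0 hp1 t b he.2)
    by_cases h1 : ((b 1 \ t 1) ∩ (b 0 ∪ b 2)).Nonempty
    · obtain ⟨e, he⟩ := h1
      rw [mem_inter, mem_sdiff] at he
      have hlt := excess_erase_lt₁ t b he.1.1 he.1.2 he.2
      exact (ih _ _ (subset_update_erase htb 1 he.1.2) (by omega)).trans (T3cyl_erase_le₁ hp0 hp1 t b he.2)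
    by_cases h2 : ((b 2 \ t 2) ∩ (b 0 ∪ b 1)).Nonempty
    · obtain ⟨e, he⟩ := h2
      rw [mem_inter, mem_sdiff] at he
      have hlt := excess_erase_lt₂ t b he.1.1 he.1.2 he.2
      exact (ih _ _ (subset_update_erase htb 2 he.1.2) (by omega)).trans (T3cyl_erase_le₂ hp0 hp1 t b he.2)
    rw [not_nonempty_iff_eq_empty] at h0 h1 h2
    exact T3cyl_nonneg_of_frozen hp0 hp1 htb h0 h1 h2

/-- **`T₃ ≥ 0` FOR CYLINDER PAIRS** on the cube `{0,1}^ι` with any product measure. [this work] -/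
theorem T3cyl_nonneg [Fintype ι] (hp0 : ∀ e, 0 ≤ p e) (hp1 : ∀ e, p e ≤ 1) {t b : Fin 3 → Finset ι} (htb : ∀ l, t l ⊆ b l) :
    0 ≤ T3cyl p t b :=
  T3cyl_nonneg_aux hp0 hp1 (excess t b) t b htb le_rfl


/-! ### The contraction inequality for cylinder pairs under `bernoulliWeight` -/

section Bridge

variable [Fintype ι]

omit [DecidableEq ι] in
/-- `E_μ(1_{C(A)}) = ∏_{e∈A} p_e` for `μ = bernoulliWeight p`. [this work] -/
theorem ex_ind_cyl (q : ι → unitInterval) (A : Finset ι) :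
    ex (bernoulliWeight q) (ind {ω : Set ι | (A : Set ι) ⊆ ω}) = cylMass (fun e => (q e : ℝ)) A := by
  rw [ex_bernoulliWeight_ind, prodBernoulli_real_subset]; rfl

/-- `E_μ(1_{C(A)}·1_{C(B)}) = ∏_{e ∈ A ∪ B} p_e`. [this work] -/
theorem ex_ind_cyl₂ (q : ι → unitInterval) (A B : Finset ι) :
    ex (bernoulliWeight q) (ind {ω : Set ι | (A : Set ι) ⊆ ω} * ind {ω : Set ι | (B : Set ι) ⊆ ω}) = cylMass (fun e => (q e : ℝ)) (A ∪ B) := by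
  -- (the tree's `ind_mul_ind_eq_inter` / `Quant.setOf_subset_inter`, restated locally to keep the imports light)
  have h : ind {ω : Set ι | (A : Set ι) ⊆ ω} * ind {ω : Set ι | (B : Set ι) ⊆ ω} = ind {ω : Set ι | ((A ∪ B : Finset ι) : Set ι) ⊆ ω} := by
    funext ω
    simp only [Pi.mul_apply]
    by_cases hA : (A : Set ι) ⊆ ω <;> by_cases hB : (B : Set ι) ⊆ ω <;>
      simp [ind_of_mem, ind_of_not_mem, hA, hB, coe_union, Set.union_subset_iff]
  rw [h, ex_ind_cyl]

/-- `E_μ(1_{C(A)}·1_{C(B)}·1_{C(D)}) = ∏_{e ∈ A ∪ B ∪ D} p_e`. [this work] -/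
theorem ex_ind_cyl₃ (q : ι → unitInterval) (A B D : Finset ι) :
    ex (bernoulliWeight q) (ind {ω : Set ι | (A : Set ι) ⊆ ω} * ind {ω : Set ι | (B : Set ι) ⊆ ω} * ind {ω : Set ι | (D : Set ι) ⊆ ω})
      = cylMass (fun e => (q e : ℝ)) (A ∪ B ∪ D) := by
  have h : ind {ω : Set ι | (A : Set ι) ⊆ ω} * ind {ω : Set ι | (B : Set ι) ⊆ ω} * ind {ω : Set ι | (D : Set ι) ⊆ ω}
      = ind {ω : Set ι | ((A ∪ B ∪ D : Finset ι) : Set ι) ⊆ ω} := by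
    funext ω
    simp only [Pi.mul_apply]
    by_cases hA : (A : Set ι) ⊆ ω <;> by_cases hB : (B : Set ι) ⊆ ω <;> by_cases hD : (D : Set ι) ⊆ ω <;>
      simp [ind_of_mem, ind_of_not_mem, hA, hB, hD, coe_union, Set.union_subset_iff]
  rw [h, ex_ind_cyl]

/-- **THE CONTRACTION INEQUALITY FOR CYLINDER PAIRS ON A CUBE.**  For the product measure `μ = bernoulliWeight q` on `Set ι`, a coin
`s ∈ [0,1]`, and cylinder pairs `t_i ⊆ b_i`:  `s · E₃^{μ}(1_{C(t₀)}, 1_{C(t₁)}, 1_{C(t₂)}) ≤ E₃^{B_s⊗μ}(F₀, F₁, F₂)`,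
`F_i(ε, ω) = ε ? 1_{C(t_i)} ω : 1_{C(b_i)} ω`.  Equivalently `s ↦ E₃^{B_s⊗μ}(F)/s` is non-increasing and `T₃ = E₃(1) − E₃′(1) ≥ 0`: Conjecture T₃
holds for cylinder pairs on every cube. [this work] -/
theorem sahiE_three_coin_cylinders_ge (q : ι → unitInterval) {s : ℝ} (hs₀ : 0 ≤ s) (hs₁ : s ≤ 1) {t b : Fin 3 → Finset ι}
    (htb : ∀ l, t l ⊆ b l) :
    s * sahiE (bernoulliWeight q) 3 ![ind {ω : Set ι | (t 0 : Set ι) ⊆ ω}, ind {ω : Set ι | (t 1 : Set ι) ⊆ ω}, ind {ω : Set ι | (t 2 : Set ι) ⊆ ω}] ≤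
      sahiE (fun z : Bool × Set ι => if z.1 then s * bernoulliWeight q z.2 else (1 - s) * bernoulliWeight q z.2) 3
        ![fun z => if z.1 then ind {ω : Set ι | (t 0 : Set ι) ⊆ ω} z.2 else ind {ω : Set ι | (b 0 : Set ι) ⊆ ω} z.2,
          fun z => if z.1 then ind {ω : Set ι | (t 1 : Set ι) ⊆ ω} z.2 else ind {ω : Set ι | (b 1 : Set ι) ⊆ ω} z.2,
          fun z => if z.1 then ind {ω : Set ι | (t 2 : Set ι) ⊆ ω} z.2 else ind {ω : Set ι | (b 2 : Set ι) ⊆ ω} z.2] := by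
  set μ := bernoulliWeight q with hμ
  have hq0 : ∀ e, 0 ≤ ((q e : ℝ)) := fun e => (q e).2.1
  have hq1 : ∀ e, ((q e : ℝ)) ≤ 1 := fun e => (q e).2.2
  have key := SahiTangent.sahiE_three_sections μ μ s
    ![fun z => if z.1 then ind {ω : Set ι | (t 0 : Set ι) ⊆ ω} z.2 else ind {ω : Set ι | (b 0 : Set ι) ⊆ ω} z.2,
      fun z => if z.1 then ind {ω : Set ι | (t 1 : Set ι) ⊆ ω} z.2 else ind {ω : Set ι | (b 1 : Set ι) ⊆ ω} z.2,
      fun z => if z.1 then ind {ω : Set ι | (t 2 : Set ι) ⊆ ω} z.2 else ind {ω : Set ι | (b 2 : Set ι) ⊆ ω} z.2]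
  simp only [Matrix.cons_val_zero, Matrix.cons_val_one, Matrix.cons_val_two, Matrix.head_cons, Matrix.tail_cons,
    if_true, if_false, Bool.false_eq_true] at key
  -- eta-contract the sections and name the products
  have e : ∀ A : Finset ι, (fun ω => ind {ω : Set ι | (A : Set ι) ⊆ ω} ω) = ind {ω : Set ι | (A : Set ι) ⊆ ω} := fun A => rfl
  have m2 : ∀ A B : Finset ι, (fun ω => ind {ω : Set ι | (A : Set ι) ⊆ ω} ω * ind {ω : Set ι | (B : Set ι) ⊆ ω} ω) =
      ind {ω : Set ι | (A : Set ι) ⊆ ω} * ind {ω : Set ι | (B : Set ι) ⊆ ω} := fun A B => rfl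
  have m3 : ∀ A B D : Finset ι, (fun ω => ind {ω : Set ι | (A : Set ι) ⊆ ω} ω * ind {ω : Set ι | (B : Set ι) ⊆ ω} ω
      * ind {ω : Set ι | (D : Set ι) ⊆ ω} ω) =
      ind {ω : Set ι | (A : Set ι) ⊆ ω} * ind {ω : Set ι | (B : Set ι) ⊆ ω} * ind {ω : Set ι | (D : Set ι) ⊆ ω} := fun A B D => rfl
  simp only [e, m2, m3, hμ, ex_ind_cyl, ex_ind_cyl₂, ex_ind_cyl₃] at key
  -- the three nonnegative ingredients
  have hT : 0 ≤ T3cyl (fun e => (q e : ℝ)) t b := T3cyl_nonneg hq0 hq1 htb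
  have hc₀ : 0 ≤ sahiE μ 3 ![ind {ω : Set ι | (b 0 : Set ι) ⊆ ω}, ind {ω : Set ι | (b 1 : Set ι) ⊆ ω}, ind {ω : Set ι | (b 2 : Set ι) ⊆ ω}] := by
    rw [hμ, sahiE_three]
    simp only [ex_ind_cyl, ex_ind_cyl₂, ex_ind_cyl₃]
    have h := E3cyl_nonneg hq0 hq1 b
    linarith
  have hD : 0 ≤ (cylMass (fun e => (q e : ℝ)) (t 0) - cylMass (fun e => (q e : ℝ)) (b 0))
      * (cylMass (fun e => (q e : ℝ)) (t 1) - cylMass (fun e => (q e : ℝ)) (b 1))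
      * (cylMass (fun e => (q e : ℝ)) (t 2) - cylMass (fun e => (q e : ℝ)) (b 2)) :=
    mul_nonneg (mul_nonneg (sub_nonneg.2 (cylMass_anti hq0 hq1 (htb 0))) (sub_nonneg.2 (cylMass_anti hq0 hq1 (htb 1))))
      (sub_nonneg.2 (cylMass_anti hq0 hq1 (htb 2)))
  have hT' : 0 ≤ 2 * cylMass (fun e => (q e : ℝ)) (b 0 ∪ b 1 ∪ b 2)
      + (cylMass (fun e => (q e : ℝ)) (t 0) - cylMass (fun e => (q e : ℝ)) (b 0)) * cylMass (fun e => (q e : ℝ)) (t 1 ∪ t 2)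
      + (cylMass (fun e => (q e : ℝ)) (t 1) - cylMass (fun e => (q e : ℝ)) (b 1)) * cylMass (fun e => (q e : ℝ)) (t 0 ∪ t 2)
      + (cylMass (fun e => (q e : ℝ)) (t 2) - cylMass (fun e => (q e : ℝ)) (b 2)) * cylMass (fun e => (q e : ℝ)) (t 0 ∪ t 1)
      + cylMass (fun e => (q e : ℝ)) (b 0) * cylMass (fun e => (q e : ℝ)) (t 1) * cylMass (fun e => (q e : ℝ)) (t 2)
      + cylMass (fun e => (q e : ℝ)) (b 1) * cylMass (fun e => (q e : ℝ)) (t 0) * cylMass (fun e => (q e : ℝ)) (t 2)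
      + cylMass (fun e => (q e : ℝ)) (b 2) * cylMass (fun e => (q e : ℝ)) (t 0) * cylMass (fun e => (q e : ℝ)) (t 1)
      - cylMass (fun e => (q e : ℝ)) (t 0) * cylMass (fun e => (q e : ℝ)) (b 1 ∪ b 2)
      - cylMass (fun e => (q e : ℝ)) (t 1) * cylMass (fun e => (q e : ℝ)) (b 0 ∪ b 2)
      - cylMass (fun e => (q e : ℝ)) (t 2) * cylMass (fun e => (q e : ℝ)) (b 0 ∪ b 1)
      - 2 * (cylMass (fun e => (q e : ℝ)) (t 0) * cylMass (fun e => (q e : ℝ)) (t 1) * cylMass (fun e => (q e : ℝ)) (t 2)) := by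
    have h := hT; unfold T3cyl at h; exact h
  rw [hμ] at hc₀
  have h1s : 0 ≤ 1 - s := sub_nonneg.2 hs₁
  nlinarith [key, mul_nonneg h1s (mul_nonneg h1s hc₀), mul_nonneg h1s (mul_nonneg hs₀ hT'),
    mul_nonneg h1s (mul_nonneg (mul_nonneg hs₀ h1s) hD)]

end Bridge

end

end Summit.CriticalPhenomena.PercolationContinuityZ3.Theorems.SahiTangentCyl
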